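import Mathlib.CategoryTheory.Action.Basic
import Mathlib.CategoryTheory.Action.Limits
import Mathlib.CategoryTheory.ObjectProperty.FullSubcategory
import Mathlib.CategoryTheory.Limits.Preserves.Finite
import Mathlib.CategoryTheory.Subobject.Lattice
import Mathlib.CategoryTheory.Subobject.ArtinianObject
import Mathlib.CategoryTheory.Subobject.NoetherianObject
import Mathlib.CategoryTheory.Simple
import Mathlib.Algebra.Algebra.Opposite
import Mathlib.Algebra.BrauerGroup.Defs
import Mathlib.RingTheory.TensorProduct.Basic
import Mathlib.RingTheory.SimpleModule.Basic
import Mathlib.RingTheory.SimpleRing.Basic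
import Mathlib.RingTheory.Spectrum.Maximal.Defs
import Mathlib.LinearAlgebra.Semisimple
import Mathlib.LinearAlgebra.Charpoly.Basic
import Mathlib.FieldTheory.IntermediateField.Adjoin.Defs
import Mathlib.FieldTheory.Minpoly.Field
import Literature.CategoryTheory.Abelian.SemisimpleObjects
import HarnessLib

/-!
# Kottwitz 1992, §3 «Semisimple categories» (statement carpet: Lemmas 3.1–3.3, Corollary 3.4, Lemma 3.5)

R. E. Kottwitz, *Points on some Shimura varieties over finite fields*, J. Amer. Math. Soc. **5** (1992) 373–444
[Kottwitz1992], §3, pp. 382–385 (held text `paper:doi-10-2307-2152772`, pdf `p00NN` = printed page `372 + NN`: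
p0010 L45 – p0013 L33).  Squad TK (HCML «GO 500»), typer TK-t01; target
`Literature/NumberTheory/Kottwitz1992/SemisimpleCategories.lean`, namespace
`Literature.NumberTheory.Kottwitz1992.SemisimpleCategories`.  STATEMENTS ONLY (cell TYPER LINT RULE: no proof, no
`sorry`, no `axiom`, no `instance`, no `notation`): the numbered statements are named facts
`def Kottwitz1992_3_<m>_<name> : Prop := …`; auxiliary notions are `def`s with bodies.

## The print and the Lean rendering

§3 opens (p. 382–383): «Let `𝒞` be an abelian category in which every object has finite length. … Recall that `𝒞`
is said to be semisimple if all its objects are semisimple. … LEMMA 3.1. Suppose that for every object `X` of `𝒞`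
the endomorphism ring `End(X)` is semisimple. Then `𝒞` is semisimple.»  Then: «Let `L` be a field of characteristic
0, and let `𝒞` be a semisimple `L`-linear abelian category in which `Hom(X, Y)` is finite-dimensional over `L` …
Let `B` be a finite-dimensional semisimple `L`-algebra and let `𝒞_B` be the category of `B`-objects in `𝒞`: the
objects of `𝒞_B` are pairs `(X, i)` consisting of an object `X` in `𝒞` and an `L`-algebra homomorphism
`i : B → End(X)`, and a morphism from `(X, i)` to `(Y, j)` is a morphism `f : X → Y` in `𝒞` such that
`f ∘ i(b) = j(b) ∘ f` for all `b ∈ B`. Let `F` be the center of `B` …»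

* LEMMAS 3.1, 3.2 are typed in Mathlib's abelian-category language: «every object has finite length» =
  `IsArtinianObject X ∧ IsNoetherianObject X`; «semisimple object» = the tree's
  `Literature.CategoryTheory.KrullSchmidt.IsSemisimpleObj` (finite sum of simple objects; `↔ ComplementedLattice
  (Subobject X)` for objects of finite length, `isSemisimpleObj_iff_complementedLattice`, PROVED there); `End(X)` =
  `CategoryTheory.End X` (a ring for `𝒞` preadditive, an `L`-algebra for `𝒞` `L`-linear — Mathlib).  The category
  `𝒞_B` of `B`-objects is the FULL SUBCATEGORY of Mathlib's `Action 𝒞 B` (objects `(X, ρ : B →* End X)`, morphisms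
  intertwining `ρ`) on the actions `ρ` that are `L`-ALGEBRA maps (`IsAlgAction`: additive and `L`-homogeneous);
  `BObj L 𝒞 B := (IsAlgAction L 𝒞 B).FullSubcategory` (Mathlib `ObjectProperty.FullSubcategory`, with its category
  instance and inclusion `ι`), forgetful functor `(IsAlgAction L 𝒞 B).ι ⋙ Action.forget 𝒞 B`.  «`𝒞_B` is abelian
  and semisimple … simple `(X, i)` …» = `∃ (an `Abelian` structure on the given category `BObj L 𝒞 B`), every object
  has a complemented subobject lattice ∧ …` (the subobject lattice of `𝒞_B` needs the abelian structure to be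
  stated); «simple» = `IsSimpleOrder (Subobject X)`; «`X` isotypic of type `Y`» = `X ≅ Y^⊕s`.  Abelian categories
  carry `[HasFiniteBiproducts]` explicitly (Mathlib's `Abelian.hasFiniteBiproducts` is not a global instance).
  DEDUP: Lemma 3.1 FOR MODULE CATEGORIES (finite-length modules over a ring) is the tree's THEOREM
  `Literature.RingTheory.SimpleModule.isSemisimpleModule_of_forall_isSemisimpleRing_moduleEnd`
  (`RingTheory/SimpleModule/SemisimpleOfSemisimpleEndomorphismRings.lean`, which follows Kottwitz's proof); the
  abelian-category statement AS PRINTED is recorded here as the named fact `Kottwitz1992_3_1_…` (not a restatement: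
  strictly more general carrier).
* LEMMA 3.3 is typed in the REDUCED MODEL of its own proof (p. 384: «As in the proof of the previous lemma it is
  enough to consider the case in which `𝒞` is the category of finitely generated left modules over the division
  algebra `D^opp`.  Then `𝒞_B` is equivalent to the category of finitely generated left `D' := B ⊗_L D^opp`-modules.
  The center of `D'` is `F ⊗_L M = M₁ × ⋯ × M_r` …»): `Y` ↔ the division `L`-algebra `D = End(Y)` with centre `M`,
  `𝒞_B` ↔ modules over `D' = B ⊗[L] Dᵐᵒᵖ`, simple objects `(X, i)` ↔ simple `D'`-modules `X`, `C = End_{𝒞_B}(X, i)`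
  ↔ `Module.End D' X`, the factor `M_j = E` ↔ a maximal ideal of `F ⊗[L] M` (the annihilator of `X`), and `E`, its
  structure maps `F → E ← M` and `E = centre(C)` are PARAMETERS constrained by hypotheses (the canonical maps are
  `f ↦ (f ⊗ 1)·`, `z ↦ (1 ⊗ z)·` on `X`).  The Brauer-group identity «`[C] = [D ⊗_M E] − [B ⊗_F E]`» is written, as
  in the tree's `RingTheory/CentralSimple/BrauerGroupLaw.lean` and Mathlib's `IsBrauerEquivalent`, in SIMILARITY
  FORM `[C ⊗_E (E ⊗_F B)] = [E ⊗_M D]`: `M_r(C ⊗_E (E ⊗_F B)) ≃ₐ[E] M_t(E ⊗_M D)` for some `r, t ≥ 1` (Mathlib's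
  `BrauerGroup K` is a bare quotient without group law).  `B` is taken SIMPLE with centre the field `F`
  — TODO(general form): `B` semisimple with centre a product of fields (apply factorwise).
* COROLLARY 3.4 and LEMMA 3.5 (p. 385) concern the concrete category «of pairs `(V, γ)`, where `V` is a
  finite-dimensional `L`-vector space and `γ` is a semisimple automorphism of `V`», `B` central simple of dimension
  `d²` over `L`; a `B`-object is «a finite-dimensional `B`-module `V` together with a semisimple automorphism `γ` of
  the `B`-module `V`» — here `γ : V ≃ₗ[B] V` with `Module.End.IsSemisimple (γ|_L)` (`IsObject`), simple =
  `IsSimpleObject` (no proper non-zero `γ`-stable `B`-submodule); «`a ∈ L̄^×` up to conjugacy over `L`» is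
  presented by a pair `(E, a)`, `E ⊇ L` a finite extension generated by `a ≠ 0` (`IsGeneratedByUnit`; `E = L[a]`,
  and `(E, a)`, `(E', a')` present conjugate elements iff `minpoly_L a = minpoly_L a'`) — this avoids fixing an
  algebraic closure; `Y_a`-isotypic = `minpoly_L(γ|_L) = minpoly_L(a)`; `End(X_a)` = the centralizer `C` of `γ` in
  `Module.End B V`, made an `E`-algebra by `a ↦ γ` (parameter + hypothesis).  The printed HASSE-INVARIANT
  form «`inv(C) = −[L[a] : L] inv(B)`» (for `L` a local field) is recorded in the equivalent BRAUER-CLASS form that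
  Lemma 3.3 delivers, `[C] + [B ⊗_L L[a]] = 0` in `Br(L[a])`, i.e. `C ⊗_{L[a]} (L[a] ⊗_L B) ∼ L[a]` (for a local
  field `inv` is injective and `inv_{L[a]}(B ⊗_L L[a]) = [L[a]:L]·inv_L(B)`, so the two forms say the same; the
  Brauer-class form is meaningful, and is what the printed proof gives, for every `L` of characteristic 0 — this
  holds for Corollary 3.4);  in Lemma 3.5 «`m(a)/d` kills the class of `C`» is typed in the INDEX form the printed
  proof actually establishes, `d · (dim_{L[a]} C)^{1/2} ∣ m(a)` (ED. 2, squad QA-K2: over the print's LOCAL `L`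
  period = index, so this is the print; the period form is false for a general `L`).  In Lemma 3.5 the print
  quantifies over `a ∈ L̄^×` only; since the objects carry AUTOMORPHISMS, `0` is never an eigenvalue, so the
  hypothesis `f(0) ≠ 0` — implicit in the print (all roots of a characteristic polynomial of an automorphism are
  units) — is made EXPLICIT here (without it the displayed criterion would wrongly admit `f = T^m`).

## References
* [Kottwitz1992] R. E. Kottwitz, Points on some Shimura varieties over finite fields, J. Amer. Math. Soc. 5
  (1992) 373–444, §3 pp. 382–385: Lemma 3.1 (p. 383), Lemma 3.2 (p. 383), Lemma 3.3 (p. 384), Corollary 3.4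
  (p. 385), Lemma 3.5 (p. 385).
-/

noncomputable section

open CategoryTheory CategoryTheory.Limits
open scoped TensorProduct

namespace Literature.NumberTheory.Kottwitz1992.SemisimpleCategories

universe u v w

/-! ## Lemma 3.1 (p. 383) -/

/-- **Lemma 3.1** (p. 383), for an abelian category `𝒞` «in which every object has finite length»: «Suppose that for
every object `X` of `𝒞` the endomorphism ring `End(X)` is semisimple.  Then `𝒞` is semisimple» (every object is
semisimple).  The MODULE case (finite-length modules over a ring) is PROVED in the tree:
`Literature.RingTheory.SimpleModule.isSemisimpleModule_of_forall_isSemisimpleRing_moduleEnd`.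
[cite: Kottwitz1992, Lemma 3.1 (p. 383)] -/
def Kottwitz1992_3_1_semisimple_of_end_semisimple (𝒞 : Type u) [Category.{v} 𝒞] [Abelian 𝒞]
    [HasFiniteBiproducts 𝒞] : Prop :=
  (∀ X : 𝒞, IsArtinianObject X ∧ IsNoetherianObject X) → (∀ X : 𝒞, IsSemisimpleRing (End X)) →
    ∀ X : 𝒞, Literature.CategoryTheory.KrullSchmidt.IsSemisimpleObj X

/-! ## The category `𝒞_B` of `B`-objects and Lemma 3.2 (p. 383) -/

section BObjects

variable (L : Type w) [Field L] (𝒞 : Type u) [Category.{v} 𝒞] [Preadditive 𝒞] [Linear L 𝒞]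
  (B : Type w) [Ring B] [Algebra L B]

/-- A `B`-OBJECT of `𝒞` (p. 383: «pairs `(X, i)` consisting of an object `X` in `𝒞` and an `L`-algebra homomorphism
`i : B → End(X)`»), as a property of Mathlib's monoid actions `Action 𝒞 B` (`ρ : B →* End X` multiplicative and
unital): `ρ` is moreover additive and `L`-homogeneous, i.e. an `L`-algebra map. [cite: Kottwitz1992, §3 (p. 383)] -/
def IsAlgAction : ObjectProperty (Action 𝒞 B) := fun A =>
  (∀ a b : B, A.ρ (a + b) = A.ρ a + A.ρ b) ∧ ∀ (l : L) (b : B), A.ρ (l • b) = l • A.ρ b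

/-- The category `𝒞_B` of `B`-objects in `𝒞` (p. 383): the full subcategory of `Action 𝒞 B` on `IsAlgAction`; its
morphisms are the morphisms `f : X → Y` of `𝒞` «such that `f ∘ i(b) = j(b) ∘ f` for all `b ∈ B`» (Mathlib
`Action.Hom.comm`). [cite: Kottwitz1992, §3 (p. 383)] -/
abbrev BObj : Type _ := (IsAlgAction L 𝒞 B).FullSubcategory

/-- The functor `𝒞_B → 𝒞`, `(X, i) ↦ X` (p. 383). [cite: Kottwitz1992, Lemma 3.2 (p. 383)] -/
abbrev forgetBObj : BObj L 𝒞 B ⥤ 𝒞 := (IsAlgAction L 𝒞 B).ι ⋙ Action.forget 𝒞 B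

end BObjects

/-- **Lemma 3.2** (p. 383), for `L` a field of characteristic 0, `𝒞` «a semisimple `L`-linear abelian category in
which `Hom(X, Y)` is finite-dimensional over `L` for every pair `X, Y` of objects», `B` a finite-dimensional
semisimple `L`-algebra: «The category `𝒞_B` is abelian and semisimple.  The functor `𝒞_B → 𝒞` taking `(X, i)` to `X`
is faithful and exact.  Moreover, if `(X, i)` is simple in `𝒞_B`, then `X` is isotypic in `𝒞`» (`X ≅ Y^⊕s` for a
simple `Y`). [cite: Kottwitz1992, Lemma 3.2 (p. 383)] -/
def Kottwitz1992_3_2_BObj_semisimple (L : Type w) [Field L] (𝒞 : Type u) [Category.{v} 𝒞] [Abelian 𝒞]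
    [HasFiniteBiproducts 𝒞] [Linear L 𝒞] (B : Type w) [Ring B] [Algebra L B] : Prop :=
  CharZero L → (∀ X : 𝒞, Literature.CategoryTheory.KrullSchmidt.IsSemisimpleObj X) →
    (∀ X Y : 𝒞, FiniteDimensional L (X ⟶ Y)) → FiniteDimensional L B → IsSemisimpleRing B →
      (forgetBObj L 𝒞 B).Faithful ∧ PreservesFiniteLimits (forgetBObj L 𝒞 B) ∧
        PreservesFiniteColimits (forgetBObj L 𝒞 B) ∧
      ∃ _ : Abelian (BObj L 𝒞 B),
        (∀ X : BObj L 𝒞 B, ComplementedLattice (Subobject X)) ∧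
        ∀ X : BObj L 𝒞 B, IsSimpleOrder (Subobject X) →
          ∃ (Y : 𝒞) (s : ℕ), Simple Y ∧ Nonempty (X.obj.V ≅ ⨁ fun _ : Fin s => Y)

/-! ## Lemma 3.3 (p. 384), in the reduced model `𝒞 = (Dᵐᵒᵖ-modules)`, `𝒞_B = (B ⊗_L Dᵐᵒᵖ-modules)` -/

section Lemma33

variable (L : Type u) [Field L] (F : Type u) [Field F] [Algebra L F]
  (B : Type u) [Ring B] [Algebra L B] [Algebra F B] [IsScalarTower L F B]
  (M : Type u) [Field M] [Algebra L M] (D : Type u) [DivisionRing D] [Algebra L D] [Algebra M D]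
  [IsScalarTower L M D]

/-- The structure map `M → Dᵐᵒᵖ` of the opposite algebra of `D` over its (commutative) centre `M`: `z ↦ op z`
(Mathlib `AlgHom.op` and `AlgEquiv.toOpposite`). [cite: Kottwitz1992, Lemma 3.3 (p. 384)] -/
def toMulOpposite : M →ₐ[L] Dᵐᵒᵖ :=
  (AlgHom.op (IsScalarTower.toAlgHom L M D)).comp (AlgEquiv.toOpposite L M).toAlgHom

/-- The canonical map `F ⊗_L M → D' = B ⊗_L Dᵐᵒᵖ` onto «the center of `D'`» (p. 384), `f ⊗ z ↦ f ⊗ op z`.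
[cite: Kottwitz1992, Lemma 3.3 (p. 384)] -/
def centerMap : F ⊗[L] M →ₐ[L] B ⊗[L] Dᵐᵒᵖ :=
  Algebra.TensorProduct.map (IsScalarTower.toAlgHom L F B) (toMulOpposite L M D)

/-- The `D'`-module `X` is annihilated by the ideal `𝔪` of `F ⊗_L M` (acting through `centerMap`); for a simple `X`
its annihilator is one of the factors «`M_j` of `F ⊗_L M = M₁ × ⋯ × M_r`» (a maximal ideal), the factor the
construction of p. 384 associates to `(X, i)`. [cite: Kottwitz1992, Lemma 3.3 (p. 384)] -/
def IsAnnihilatedBy (X : Type*) [AddCommGroup X] [Module (B ⊗[L] Dᵐᵒᵖ) X] (𝔪 : Ideal (F ⊗[L] M)) : Prop :=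
  ∀ z ∈ 𝔪, ∀ x : X, (centerMap L F B M D z) • x = 0

/-- **Lemma 3.3, first sentence** (p. 384): «This construction sets up a bijection between the set of isomorphism
classes of simple objects `(X, i)` in `𝒞_B` such that `X` is isotypic of type `Y` and the set of factors `M_j` of
`F ⊗_L M`.»  Reduced model: simple `B ⊗_L Dᵐᵒᵖ`-modules up to isomorphism ↔ maximal ideals of `F ⊗_L M`, via the
annihilator — (a) every simple module is annihilated by exactly one maximal ideal, (b) simple modules with the same
annihilator are isomorphic, (c) every maximal ideal occurs.  `B` simple with centre `F`, `D` a division algebra with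
centre `M` (as printed: `D = End(Y)`, `Y` simple). [cite: Kottwitz1992, Lemma 3.3 (p. 384)] -/
def Kottwitz1992_3_3_simple_objects_bijection : Prop :=
  CharZero L → FiniteDimensional L B → IsSimpleRing B →
    Set.range (algebraMap F B) = (Subalgebra.center L B : Set B) →
    FiniteDimensional L D → Set.range (algebraMap M D) = (Subalgebra.center L D : Set D) →
    (∀ (X : Type u) [AddCommGroup X] [Module (B ⊗[L] Dᵐᵒᵖ) X], IsSimpleModule (B ⊗[L] Dᵐᵒᵖ) X →
      ∃! 𝔪 : MaximalSpectrum (F ⊗[L] M), IsAnnihilatedBy L F B M D X 𝔪.asIdeal) ∧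
    (∀ (X : Type u) [AddCommGroup X] [Module (B ⊗[L] Dᵐᵒᵖ) X] (X' : Type u) [AddCommGroup X']
      [Module (B ⊗[L] Dᵐᵒᵖ) X'] (𝔪 : MaximalSpectrum (F ⊗[L] M)),
      IsSimpleModule (B ⊗[L] Dᵐᵒᵖ) X → IsSimpleModule (B ⊗[L] Dᵐᵒᵖ) X' →
      IsAnnihilatedBy L F B M D X 𝔪.asIdeal → IsAnnihilatedBy L F B M D X' 𝔪.asIdeal → Nonempty (X ≃ₗ[B ⊗[L] Dᵐᵒᵖ] X')) ∧
    (∀ 𝔪 : MaximalSpectrum (F ⊗[L] M), ∃ (X : Type u) (_ : AddCommGroup X) (_ : Module (B ⊗[L] Dᵐᵒᵖ) X),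
      IsSimpleModule (B ⊗[L] Dᵐᵒᵖ) X ∧ IsAnnihilatedBy L F B M D X 𝔪.asIdeal)

/-- **Lemma 3.3, second and third sentences** (p. 384): with `D = End(Y)` (centre `M`, `n² = dim_M D`), `(X, i)`
simple in `𝒞_B` with `X ≅ Y^s`, `C = End_{𝒞_B}(X, i)` (centre `E`, `m² = dim_E C`), `E` = the factor `M_j` of
`F ⊗_L M` (an `F`- and `M`-algebra), `d² = dim_E (B ⊗_F E)`: «The class `[C]` of `C` in the Brauer group of `E` is
equal to `[D ⊗_M E] − [B ⊗_F E]`.  The numbers `n, m, s` are related by the equality `sn = d[E : M]m`.»  Reduced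
model: `X` a simple `D' = B ⊗_L Dᵐᵒᵖ`-module, `s = dim_{Dᵐᵒᵖ} X`, `C = Module.End D' X`; `E` with its maps from
`F`, `M` and into `C` is a parameter pinned by: `E → C` is onto the centre of `C`, and `F → E → C`, `M → E → C` act on
`X` as `f ⊗ 1`, `1 ⊗ op z`.  Brauer identity in similarity form `[C ⊗_E (E ⊗_F B)] = [E ⊗_M D]`.
[cite: Kottwitz1992, Lemma 3.3 (p. 384)] -/
def Kottwitz1992_3_3_brauer_class_and_degrees : Prop :=
  CharZero L → FiniteDimensional L B → IsSimpleRing B →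
    Set.range (algebraMap F B) = (Subalgebra.center L B : Set B) →
    FiniteDimensional L D → Set.range (algebraMap M D) = (Subalgebra.center L D : Set D) →
    ∀ (X : Type u) [AddCommGroup X] [Module (B ⊗[L] Dᵐᵒᵖ) X] [Module Dᵐᵒᵖ X],
      IsSimpleModule (B ⊗[L] Dᵐᵒᵖ) X → (∀ (z : Dᵐᵒᵖ) (x : X), z • x = ((1 : B) ⊗ₜ[L] z) • x) →
    ∀ (E : Type u) [Field E] [Algebra L E] [Algebra F E] [Algebra M E] [IsScalarTower L F E]
      [IsScalarTower L M E] [Algebra E (Module.End (B ⊗[L] Dᵐᵒᵖ) X)],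
      Set.range (algebraMap E (Module.End (B ⊗[L] Dᵐᵒᵖ) X)) =
          (Subring.center (Module.End (B ⊗[L] Dᵐᵒᵖ) X) : Set (Module.End (B ⊗[L] Dᵐᵒᵖ) X)) →
      (∀ (f : F) (x : X), algebraMap E (Module.End (B ⊗[L] Dᵐᵒᵖ) X) (algebraMap F E f) x =
          (algebraMap F B f ⊗ₜ[L] (1 : Dᵐᵒᵖ)) • x) →
      (∀ (z : M) (x : X), algebraMap E (Module.End (B ⊗[L] Dᵐᵒᵖ) X) (algebraMap M E z) x =
          ((1 : B) ⊗ₜ[L] MulOpposite.op (algebraMap M D z)) • x) →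
      (∃ r t : ℕ, r ≠ 0 ∧ t ≠ 0 ∧
        Nonempty (Matrix (Fin r) (Fin r) (Module.End (B ⊗[L] Dᵐᵒᵖ) X ⊗[E] (E ⊗[F] B)) ≃ₐ[E]
          Matrix (Fin t) (Fin t) (E ⊗[M] D))) ∧
      ∃ n m d : ℕ, Module.finrank M D = n ^ 2 ∧ Module.finrank E (Module.End (B ⊗[L] Dᵐᵒᵖ) X) = m ^ 2 ∧
        Module.finrank E (E ⊗[F] B) = d ^ 2 ∧
        Module.finrank Dᵐᵒᵖ X * n = d * Module.finrank M E * m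

end Lemma33

/-! ## Corollary 3.4 and Lemma 3.5 (p. 385): `B`-modules with a semisimple automorphism -/

section Pairs

variable (L : Type u) [Field L] (B : Type u) [Ring B] [Algebra L B]
  (V : Type u) [AddCommGroup V] [Module L V] [Module B V] [IsScalarTower L B V]

/-- An object of `𝒞_B` for «`𝒞` the category of pairs `(V, γ)`, where `V` is a finite-dimensional `L`-vector space
and `γ` is a semisimple automorphism of `V`» (p. 384–385): «a finite-dimensional `B`-module `V` together with a
semisimple automorphism `γ` of the `B`-module `V`» — `γ : V ≃ₗ[B] V` whose underlying `L`-linear map is semisimple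
(Mathlib `Module.End.IsSemisimple`). [cite: Kottwitz1992, §3 (p. 385)] -/
def IsObject (γ : V ≃ₗ[B] V) : Prop :=
  FiniteDimensional L V ∧ Module.End.IsSemisimple ((γ : V →ₗ[B] V).restrictScalars L)

/-- A SIMPLE object `(V, γ)` of `𝒞_B` (p. 385): an object with `V ≠ 0` whose only `γ`-stable `B`-submodules are `0`
and `V`. [cite: Kottwitz1992, §3 (p. 385)] -/
def IsSimpleObject (γ : V ≃ₗ[B] V) : Prop :=
  IsObject L B V γ ∧ Nontrivial V ∧ ∀ W : Submodule B V, (∀ v ∈ W, γ v ∈ W) → W = ⊥ ∨ W = ⊤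

/-- `End(V, γ)`: the endomorphisms of the object `(V, γ)` of `𝒞_B`, i.e. the `B`-linear endomorphisms of `V`
commuting with `γ` — the centralizer of `γ` in `Module.End B V`, an `L`-subalgebra. [cite: Kottwitz1992, Corollary 3.4 (p. 385)] -/
def endAlg (γ : V ≃ₗ[B] V) : Subalgebra L (Module.End B V) :=
  Subalgebra.centralizer L ({(γ : V →ₗ[B] V)} : Set (Module.End B V))

/-- «Elements of `L̄^×` up to conjugacy over `L`» (p. 385) are presented by pairs `(E, a)`: a finite field extension
`E = L[a]` generated by a NON-ZERO element `a` (two such present the same class iff `minpoly_L a` agree).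
[cite: Kottwitz1992, Corollary 3.4 (p. 385)] -/
def IsGeneratedByUnit (E : Type u) [Field E] [Algebra L E] (a : E) : Prop :=
  FiniteDimensional L E ∧ IntermediateField.adjoin L {a} = ⊤ ∧ a ≠ 0

/-- `(V, γ)` is (an object whose underlying pair is) ISOTYPIC OF TYPE `Y_a = (L[a], a·)` (p. 385): the minimal
polynomial of `γ` over `L` is that of `a` (then `γ` is semisimple and `V ≅ L[a]^s` as `L[γ]`-module).
[cite: Kottwitz1992, Corollary 3.4 (p. 385)] -/
def IsIsotypicOfType (γ : V ≃ₗ[B] V) {E : Type u} [Field E] [Algebra L E] (a : E) : Prop :=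
  minpoly L ((γ : V →ₗ[B] V).restrictScalars L) = minpoly L a

/-- **Corollary 3.4** (p. 385), for `B` a central simple algebra of dimension `d²` over `L` (characteristic 0) and
`X_a` «a simple object in `𝒞_B` such that the object of `𝒞` underlying `X_a` is isotypic of type `Y_a`»: «The
construction `a ↦ X_a` sets up a bijection between elements of `L̄^×` up to conjugacy over `L` and isomorphism
classes of simple objects in `𝒞_B`.  The endomorphism algebra `End(X_a)` is a central division algebra `C` over
`L[a]` whose Hasse invariant is given by `inv(C) = −[L[a] : L] inv(B)`.  Moreover the dimension of the `L`-vector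
space underlying `X_a` is `d [L[a] : L] (dim_{L[a]} C)^{1/2}`.»  Rendered with `a ∈ L̄^×` presented as `(E, a)`,
`E = L[a]` (`IsGeneratedByUnit`): (1a) existence of `X_a`, (1b) simple objects with the same minimal polynomial
(= conjugate `a`) are isomorphic, (1c) every simple object is an `X_a`; (2) for `C = End(X_a)` made an
`E`-algebra by `a ↦ γ` (parameter + hypothesis): `C` is a division ring with centre `E`, BRAUER-CLASS FORM of the
invariant identity `[C] = −[B ⊗_L E]`, i.e. `C ⊗_E (E ⊗_L B) ∼ E` (see the module docstring), and
`dim_L V = d · [E : L] · m` with `dim_E C = m²`. [cite: Kottwitz1992, Corollary 3.4 (p. 385)] -/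
def Kottwitz1992_3_4_simple_objects_classification (d : ℕ) : Prop :=
  CharZero L → FiniteDimensional L B → IsSimpleRing B → Algebra.IsCentral L B → Module.finrank L B = d ^ 2 →
    (∀ (E : Type u) [Field E] [Algebra L E] (a : E), IsGeneratedByUnit L E a →
      ∃ (V : Type u) (_ : AddCommGroup V) (_ : Module L V) (_ : Module B V) (_ : IsScalarTower L B V)
        (γ : V ≃ₗ[B] V), IsSimpleObject L B V γ ∧ IsIsotypicOfType L B V γ a) ∧
    (∀ (V : Type u) [AddCommGroup V] [Module L V] [Module B V] [IsScalarTower L B V] (γ : V ≃ₗ[B] V)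
      (V' : Type u) [AddCommGroup V'] [Module L V'] [Module B V'] [IsScalarTower L B V'] (γ' : V' ≃ₗ[B] V'),
      IsSimpleObject L B V γ → IsSimpleObject L B V' γ' →
      minpoly L ((γ : V →ₗ[B] V).restrictScalars L) = minpoly L ((γ' : V' →ₗ[B] V').restrictScalars L) →
        ∃ e : V ≃ₗ[B] V', ∀ v : V, e (γ v) = γ' (e v)) ∧
    (∀ (V : Type u) [AddCommGroup V] [Module L V] [Module B V] [IsScalarTower L B V] (γ : V ≃ₗ[B] V),
      IsSimpleObject L B V γ →
        ∃ (E : Type u) (_ : Field E) (_ : Algebra L E) (a : E), IsGeneratedByUnit L E a ∧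
          IsIsotypicOfType L B V γ a) ∧
    ∀ (E : Type u) [Field E] [Algebra L E] (a : E), IsGeneratedByUnit L E a →
      ∀ (V : Type u) [AddCommGroup V] [Module L V] [Module B V] [IsScalarTower L B V] (γ : V ≃ₗ[B] V),
        IsSimpleObject L B V γ → IsIsotypicOfType L B V γ a →
        ∀ [Algebra E (endAlg L B V γ)] [IsScalarTower L E (endAlg L B V γ)],
          (algebraMap E (endAlg L B V γ) a : Module.End B V) = (γ : V →ₗ[B] V) →
          (∀ c : endAlg L B V γ, c ≠ 0 → IsUnit c) ∧
          Set.range (algebraMap E (endAlg L B V γ)) =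
            (Subring.center (endAlg L B V γ) : Set (endAlg L B V γ)) ∧
          (∃ t : ℕ, t ≠ 0 ∧
            Nonempty ((endAlg L B V γ ⊗[E] (E ⊗[L] B)) ≃ₐ[E] Matrix (Fin t) (Fin t) E)) ∧
          ∃ m : ℕ, Module.finrank E (endAlg L B V γ) = m ^ 2 ∧
            Module.finrank L V = d * Module.finrank L E * m

/-- **Lemma 3.5** (p. 385), same setting, `f ∈ L[T]` monic of degree `m`, `m(a)` the multiplicity of `a ∈ L̄^×` as a
root of `f`: «The polynomial `f` arises as the characteristic polynomial of an `m`-dimensional object in `𝒞_B` if and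
only if the following statement holds for all `a ∈ L̄^×`: the number `m(a)` is divisible by `d` and the quotient
`m(a)/d` kills the class of `End(X_a)` in the Brauer group of `L[a]`.»  (`a ∈ L̄^×` presented as `(E, a)`, `E = L[a]`,
`m(a)` = root multiplicity of `a` in `f` over `E`; the hypothesis `f(0) ≠ 0`, implicit in the print, is explicit — see
the module docstring; an `m`-dimensional object with characteristic polynomial `f` is an object `(V, γ)` with
`charpoly(γ|_L) = f`, so `dim_L V = deg f = m`.)  THE «KILLS» CLAUSE IS TYPED IN INDEX FORM (ED. 2): print (p. 385):
«`m(a)/d` kills the class of `C = End(X_a)` in `Br(L[a])`», and the printed proof reads «`f` arises … if and only if …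
`m(a)` is divisible by the multiplicity of `a` in the characteristic polynomial for the simple object `X_a`. By the
corollary the latter multiplicity is `d (dim_{L[a]} C)^{1/2}` … The lemma now follows from the fact that
`(dim_{L[a]} C)^{1/2}` is the order of `C` in the Brauer group of `L[a]`»; Kottwitz assumes `L` LOCAL (p. 384), where
period = index = `m := (dim_E C)^{1/2}`, so the clause `d · m ∣ m(a)` below IS the print; over a general `L` of
characteristic `0` the period form `[C]^{m(a)/d} = 0` is strictly weaker and the equivalence is false (Albert's
generic biquaternion division algebra, `d = 4`, `f = (T − 1)⁸`: squad QA-K2, T-ref1 2026-09-02), which is why ED. 1's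
`⨂[E]^{m(a)/d} C ≃ₐ[E] M_t(E)` was withdrawn.  The separate conjunct `d ∣ m(a)` is printed and kept (it is implied).
[cite: Kottwitz1992, Lemma 3.5 (p. 385)] -/
def Kottwitz1992_3_5_charpoly_criterion (d : ℕ) (f : Polynomial L) : Prop :=
  CharZero L → FiniteDimensional L B → IsSimpleRing B → Algebra.IsCentral L B → Module.finrank L B = d ^ 2 →
    f.Monic → f.eval 0 ≠ 0 →
    ((∃ (V : Type u) (_ : AddCommGroup V) (_ : Module L V) (_ : Module B V) (_ : IsScalarTower L B V)
        (γ : V ≃ₗ[B] V) (_ : FiniteDimensional L V),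
        IsObject L B V γ ∧ ((γ : V →ₗ[B] V).restrictScalars L).charpoly = f) ↔
      ∀ (E : Type u) [Field E] [Algebra L E] (a : E), IsGeneratedByUnit L E a →
        d ∣ (f.map (algebraMap L E)).rootMultiplicity a ∧
        ∀ (V : Type u) [AddCommGroup V] [Module L V] [Module B V] [IsScalarTower L B V] (γ : V ≃ₗ[B] V),
          IsSimpleObject L B V γ → IsIsotypicOfType L B V γ a →
          ∀ [Algebra E (endAlg L B V γ)] [IsScalarTower L E (endAlg L B V γ)],
            (algebraMap E (endAlg L B V γ) a : Module.End B V) = (γ : V →ₗ[B] V) →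
            ∃ m : ℕ, Module.finrank E (endAlg L B V γ) = m ^ 2 ∧
              d * m ∣ (f.map (algebraMap L E)).rootMultiplicity a)

end Pairs

end Literature.NumberTheory.Kottwitz1992.SemisimpleCategories
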